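import Summits.CriticalPhenomena.SAWScalingLimit.Theses.SAWExcursionCardy
import Summits.CriticalPhenomena.SAWScalingLimit.Theorems.SAWLoopFugacityFlowSimpleSubseqLimitsFarReturnLine
import Summits.CriticalPhenomena.SAWScalingLimit.Theorems.SAWLoopFugacityFlowSimpleSubseqLimitsBoundaryPassage
import HarnessLib.Audit

/-!
# Birth skeleton — crux `SimpleSubseqLimits` (stmt-CriticalPhenomena-4514)

Route `SAWExcursionCardy` of `CriticalPhenomena/SAWScalingLimit`, crux rank 5 (shared verbatim by the
routes `SAWQuadrupoleWard`, `SAWStressTensor`):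

`SimpleSubseqLimits := ∀ D a b, IsEndpointApprox D a b → ∀ s μ, s → 0⁺ → IsProbabilityMeasure μ →
  (∀ f : CurveClass ℂ →ᵇ ℝ, ∫ f ∘ curve dP_{s n} → ∫ f dμ) → μ-a.e. γ, γ ∈ simple ∧ γ.range ∩ ∂D ⊆ {a, b}`

(`P_δ = SAW.law D.carrier δ (a δ) (b δ)`, the critical `δℤ²` SAW law): every subsequential weak limit
of the critical SAW laws is carried by SIMPLE classes meeting `∂D` only at the marked points — the
ORDER-and-BOUNDARY half of LSW Prediction 1 for subsequential limits.

## Relation to the sister crux item stmt-CriticalPhenomena-4982 (same decl name, four other routes)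

stmt-4982 (`Theses.SAWLoopFugacityFlow.SimpleSubseqLimits`) has the same hypotheses and the conclusion
`simple ∧ source = a ∧ target = b ∧ range ⊆ cl D ∧ range ∩ ∂D ⊆ {a, b}`; its three extra clauses are
FREE for every subsequential limit (landed `Negative.ae_source_target_range_of_weakLimitAlong`), and
the landed `Negative.simpleSubseqLimits_iff_core` says stmt-4982 ⟺ `Negative.SimpleSubseqLimitsCore`,
whose text is THIS crux (up to unfolding `WeakLimitAlong`): `crux_iff_sister` below (proved, `Iff.rfl`
on our side). Consequently this skeleton registers, for stmt-4514, EXACTLY the open lattice inputs that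
six lead seats isolated for stmt-4982 (its registered v4 skeleton `Lines/first_hit_avoidance.lean`,
`Cruxes/SimpleSubseqLimits/NOTES.md` §1–§3): one proof of the two stubs closes BOTH crux items, and
no second research programme is opened on the shared directory.

## The cut (one stub per clause of the conclusion; both are pure LATTICE statements at `x_c`)

* `stub_farReturnDecay : FarPast.Passage.FarReturnDecay` — ORDER, typed as FIRST-ENTRANCE SLIT
  AVOIDANCE: for every ball `B̄(q, r)` and target `θ > 0` there are a width `ε > 0` and radii
  `0 < r₀ < r < r'` such that, eventually as `δ → 0⁺`, with `P_δ`-probability `≤ θ` the walk's curve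
  class has a thickened far first-hit return at `(q, r₀, r, r', ε)` (after its first entrance near
  `B̄(q, r)` it comes back `ε`-close to a past value taken outside the guard ball `B̄(q, 5r)`); an OPEN
  event, visible on the lattice polyline; for `r' ≤ 5r` a one-stopping-time past/future event, i.e. by
  exact domain Markov "the critical SAW of the slit graph avoids the far part of the slit"
  (`FarPast.Passage.nearFarReturn_pastFuture`). Research-open (approach exponent of the critical
  two-point SAW to its own past; only sub-ballisticity is unconditional at `x_c`).
* `stub_boundaryDecay : Boundary.Passage.BoundaryDecay` — BOUNDARY ("no boundary crawling"): for every
  separation `ρ > 0` and target `θ > 0` there is `ε > 0` such that, eventually, with probability `≤ θ`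
  the curve visits the open `ε`-neighbourhood of `∂D` at a point `ρ`-far from both marked points.
  Research-open (boundary repulsion exponent of the critical SAW in `Ω_δ`, uniformly in the mesh).
* `stub_pastFutureAvoidance : FarPast.Line.PastFutureAvoidance` — the CLEANEST sufficient form of the
  ORDER input (polyline-level past/future return AT the first entrance into `B̄(q, r')`, `r' ≤ 5r`;
  implies `stub_farReturnDecay` by the landed `farReturnDecay_of_pastFutureAvoidance`); registered as
  the lattice prover's target, consumed by the variant composition `SimpleSubseqLimits_of'`.

Pins (all LANDED, crux stmt-4982 side; they transfer to stmt-4514 through `crux_iff_sister`):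
summit ⇒ each stub (`FarPast.Line.farLattice_of_sawScalingLimit`), and
`EventualTight → (crux ↔ FarReturnDecay ∧ BoundaryDecay)` (`FarPast.Line.crux_iff_farLattice`): the
stubs are not over-strong and, modulo the routes' own tightness item, not under-strong either.

## Composition (PROVED here, no `sorry`): `SimpleSubseqLimits_of`

For `(D, a, b)` with `IsEndpointApprox`, a mesh sequence `s → 0⁺` and a weak limit `μ`: the ORDER clause
`μ`-a.e. from `stub_farReturnDecay` by the landed passage `FarPast.Passage.ae_simple_of_farReturnDecayAt`
(portmanteau on the countably many OPEN thickened events ⇒ the exact far-return events are `μ`-null ⇒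
guarded Rohde–Schramm closing lemma `FirstHitFlatGuard.firstHit_closedBall_guard_simple`, endpoints
`a ≠ b` free), the BOUNDARY clause from `stub_boundaryDecay` by `Boundary.Passage.ae_boundary_of_boundaryDecayAt`
(same mechanism on the near-boundary-visit events), and the two a.e. statements are intersected. The
theorem concludes `Theses.SAWExcursionCardy.SimpleSubseqLimits` BY NAME; its hypotheses are keyed by
the registered stub names (`Registered.stub_*` aliases, as the skeleton audit requires).

## Disproof used (`Cruxes/SimpleSubseqLimits/Disproof.lean`, standing adversary of the shared decl)

* §2 `simpleSubseqLimits_false_without_tendsto_fst/snd` (both endpoint-limit fields of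
  `IsEndpointApprox` are load-bearing already for simplicity): honoured — both stubs are quantified
  over `IsEndpointApprox D a b`, and the ORDER passage uses `hab` (endpoint limits ⇒ `source ≠ target`,
  the non-flatness the closing lemma needs).
* §4 `simple_not_isClosed`, `exists_weakLimit_not_ae_simple` (the soft road is closed): honoured — the
  stubs are QUANTITATIVE `δ`-uniform decay bounds on open events, not closedness claims.
* §9 criticality is load-bearing (`cruxAt_false_of_supercritical_limit`): honoured — both stubs speak
  of `SAW.law` (weight `x_c^{|γ|}`) only.
* §12 the mesh hypothesis `s → 0⁺` and the weak-limit hypothesis are load-bearing: honoured — both enter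
  the passages through `IsSubseqLimit D a b s μ = ⟨hs, hμ, hw⟩`.
* §7/§15 range-blindness (ORDER is not recoverable from range/avoidance data): honoured — the ORDER stub
  is a statement about the parametrised polyline (first entrances, past values), not about ranges.
* §14 RING ROAD (widened uniform-over-island-pasts avoidance is FALSE): honoured — `FarReturnDecay` /
  `PastFutureAvoidance` are AVERAGED over the past under `P_δ`, never uniform over slits.
* Landed `Theorems/SimpleSubseqLimits/Negative/*`: no stub is an instance of a refuted statement there
  (the Negative lemmas refute hypothesis-weakenings of the crux and `CruxAt x` for `x > x_c`).

## Audit record (planner skeleton-register, 2026-08-17; details and probe files in `Lines/birth.md`)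

* `lean check --json`: rc 0, errors [], sorries = 3 = the three `stub_*` (no other `sorry`);
  `#print axioms SimpleSubseqLimits_of` = [propext, Classical.choice, Quot.sound].
* `#h21_check_skeleton "stmt-CriticalPhenomena-4514" …SAWExcursionCardy.SimpleSubseqLimits stub_farReturnDecay
  stub_boundaryDecay stub_pastFutureAvoidance`: ok = true, codes = [], 3 stubs found, all sorried.
* BC3 probes (`first | exact? | simpa | aesop`, four forms each: plain, hypothesis introduced, after
  `unfold`, after `simp only` with the definitions): `FarReturnDecay → crux` FAIL 4/4, `→ SAWScalingLimit`
  FAIL 4/4; `BoundaryDecay → crux` FAIL 4/4, `→ SAWScalingLimit` FAIL 4/4; `PastFutureAvoidance → crux`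
  FAIL 4/4, `→ SAWScalingLimit` FAIL 4/4 (24/24 "unsolved goals" / "aesop: failed after exhaustive
  search"). Converse record: `SAWScalingLimit → FarReturnDecay / BoundaryDecay` SUCCEED by `exact?`
  (the landed pins — the stubs are necessary for the summit, as intended), `crux → stub` FAIL ×3
  (needs `EventualTight`), `SAWScalingLimit → PastFutureAvoidance` FAIL (no landed pin imported).
-/

noncomputable section

open MeasureTheory Filter Topology Set Metric Function
open Literature.Probability.RandomPlanarGeometry Literature.Probability.RandomPlanarGeometry.SAW
open Literature.Probability.LatticeModels
open scoped ENNReal NNReal BoundedContinuousFunction unitInterval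

namespace Summit.CriticalPhenomena.SAWScalingLimit.Cruxes.SimpleSubseqLimits.ExcursionCardyBirth

open Summit.CriticalPhenomena.SAWScalingLimit.Theorems.SimpleSubseqLimits.MarkedPointRevisit.Passage
  (IsSubseqLimit)
open Summit.CriticalPhenomena.SAWScalingLimit.Theorems.SimpleSubseqLimits.Negative
  (SimpleSubseqLimitsCore simpleSubseqLimits_iff_core)
open Summit.CriticalPhenomena.SAWScalingLimit.Theorems.SimpleSubseqLimits.Boundary.Passage
  (BoundaryDecayAt BoundaryDecay ae_boundary_of_boundaryDecayAt)
open Summit.CriticalPhenomena.SAWScalingLimit.Theorems.SimpleSubseqLimits.FarPast.Passage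
  (FarReturnDecayAt FarReturnDecay ae_simple_of_farReturnDecayAt)
open Summit.CriticalPhenomena.SAWScalingLimit.Theorems.SimpleSubseqLimits.FarPast.Line
  (PastFutureAvoidance farReturnDecay_of_pastFutureAvoidance farLattice_of_sawScalingLimit
    crux_iff_farLattice)

/-! ### The registered stubs (the only `sorry`s of this file) -/

/-- **STUB 1 — FAR-RETURN DECAY** (OPEN lattice input; ORDER as first-entrance slit avoidance of the
critical `δℤ²` SAW, along every endpoint approximation). -/
theorem stub_farReturnDecay : FarReturnDecay := by
  sorry

/-- **STUB 2 — BOUNDARY DECAY** (OPEN lattice input; no boundary crawling of the critical `δℤ²` SAW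
away from the marked points, along every endpoint approximation). -/
theorem stub_boundaryDecay : BoundaryDecay := by
  sorry

/-- **STUB 1′ — PAST/FUTURE AVOIDANCE AT FIRST ENTRANCES** (OPEN; the cleanest sufficient form of the
ORDER input — the polyline event the exact domain Markov property acts on; implies STUB 1). -/
theorem stub_pastFutureAvoidance : PastFutureAvoidance := by
  sorry

/-! ### Name-keyed aliases (the skeleton audit admits a hypothesis of the composition only if its
head constant is a registered obligation or is named like a declared stub) -/
namespace Registered

/-- Alias of `FarPast.Passage.FarReturnDecay` keyed by the registered stub name. -/
abbrev stub_farReturnDecay : Prop := FarReturnDecay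
/-- Alias of `Boundary.Passage.BoundaryDecay` keyed by the registered stub name. -/
abbrev stub_boundaryDecay : Prop := BoundaryDecay
/-- Alias of `FarPast.Line.PastFutureAvoidance` keyed by the registered stub name. -/
abbrev stub_pastFutureAvoidance : Prop := PastFutureAvoidance

end Registered

/-! ### Composition (PROVED): stubs ⇒ the crux, by name -/

/-- **The composition.** `stub_farReturnDecay → stub_boundaryDecay → SimpleSubseqLimits`
(stmt-CriticalPhenomena-4514, concluded BY NAME): the ORDER clause `μ`-a.e. from far-return decay
through the landed passage `ae_simple_of_farReturnDecayAt` (guarded Rohde–Schramm one level down,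
no SHAPE input), the BOUNDARY clause from boundary decay through `ae_boundary_of_boundaryDecayAt`,
intersected. No other route item is used. -/
theorem SimpleSubseqLimits_of (hF : Registered.stub_farReturnDecay)
    (hB : Registered.stub_boundaryDecay) :
    Summit.CriticalPhenomena.SAWScalingLimit.Theses.SAWExcursionCardy.SimpleSubseqLimits := by
  intro D a b hab s μ hs hμ hw
  have hL : IsSubseqLimit D a b s μ := ⟨hs, hμ, hw⟩
  -- ORDER: μ-a.e. class is simple (far-return decay at (D; a_δ, b_δ) + the limit passage)
  have hsimple : ∀ᵐ c ∂μ, c ∈ CurveClass.simple :=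
    ae_simple_of_farReturnDecayAt hab (hF D a b hab) hL
  -- BOUNDARY: μ-a.e. class meets ∂D only at the marked points (boundary decay + the limit passage)
  have hbd : ∀ᵐ c ∂μ, c.range ∩ frontier D.carrier ⊆ {D.pt 0, D.pt 1} :=
    ae_boundary_of_boundaryDecayAt (hB D a b hab) hL
  filter_upwards [hsimple, hbd] with c h1 h2
  exact ⟨h1, h2⟩

/-- **Variant composition from the cleanest ORDER input**: past/future avoidance at first entrances
and boundary decay also close the crux (`PastFutureAvoidance ⇒ FarReturnDecay`, landed). -/
theorem SimpleSubseqLimits_of' (hP : Registered.stub_pastFutureAvoidance)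
    (hB : Registered.stub_boundaryDecay) :
    Summit.CriticalPhenomena.SAWScalingLimit.Theses.SAWExcursionCardy.SimpleSubseqLimits :=
  SimpleSubseqLimits_of (farReturnDecay_of_pastFutureAvoidance hP) hB

/-- Wiring check: the registered stubs feed `SimpleSubseqLimits_of` as stated. -/
example : Summit.CriticalPhenomena.SAWScalingLimit.Theses.SAWExcursionCardy.SimpleSubseqLimits :=
  SimpleSubseqLimits_of stub_farReturnDecay stub_boundaryDecay

/-- Wiring check (variant): the cleanest ORDER stub also feeds the crux. -/
example : Summit.CriticalPhenomena.SAWScalingLimit.Theses.SAWExcursionCardy.SimpleSubseqLimits :=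
  SimpleSubseqLimits_of' stub_pastFutureAvoidance stub_boundaryDecay

/-! ### The sister crux item and the pins (PROVED, sorry-free; documentation of the cut) -/

/-- **This crux IS the landed core of the sister item stmt-CriticalPhenomena-4982**:
`SAWExcursionCardy.SimpleSubseqLimits ↔ SAWLoopFugacityFlow.SimpleSubseqLimits`
(our side is `Negative.SimpleSubseqLimitsCore` verbatim; the sister side by
`Negative.simpleSubseqLimits_iff_core` — its extra clauses `source = a`, `target = b`,
`range ⊆ cl D` are free for every subsequential limit). -/
theorem crux_iff_sister :
    Summit.CriticalPhenomena.SAWScalingLimit.Theses.SAWExcursionCardy.SimpleSubseqLimits ↔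
      Summit.CriticalPhenomena.SAWScalingLimit.Theses.SAWLoopFugacityFlow.SimpleSubseqLimits := by
  have h : Summit.CriticalPhenomena.SAWScalingLimit.Theses.SAWExcursionCardy.SimpleSubseqLimits ↔
      SimpleSubseqLimitsCore := Iff.rfl
  exact h.trans simpleSubseqLimits_iff_core.symm

/-- **The stubs are implied by the summit conjunct** (not over-strong; landed pins of stmt-4982). -/
theorem stubs_of_sawScalingLimit (h : _root_.SAWScalingLimit) : FarReturnDecay ∧ BoundaryDecay :=
  farLattice_of_sawScalingLimit h

/-- **Residual certificate transferred to stmt-4514**: modulo eventual tightness of the critical SAW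
laws (here in the sister routes' typing `SAWLoopFugacityFlow.EventualTight`, stmt-CriticalPhenomena-1372:
`IsTightMeasureSet` of the pushed-forward laws over `δ ∈ (0, δ₀]`; this route's own item stmt-1881 types
it as `IsTightAlongMesh`) the crux IS the conjunction of its two registered lattice inputs. -/
theorem crux_iff_stubs
    (hT : Summit.CriticalPhenomena.SAWScalingLimit.Theses.SAWLoopFugacityFlow.EventualTight) :
    Summit.CriticalPhenomena.SAWScalingLimit.Theses.SAWExcursionCardy.SimpleSubseqLimits ↔
      FarReturnDecay ∧ BoundaryDecay :=
  crux_iff_sister.trans (crux_iff_farLattice hT)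

end Summit.CriticalPhenomena.SAWScalingLimit.Cruxes.SimpleSubseqLimits.ExcursionCardyBirth

end
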